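import Summits.QuantumFields.BalabanUV.Beta.EriceRemainderEnclosureHistoryAutonomyContinuity
import Summits.QuantumFields.BalabanUV.Beta.EriceRemainderEnclosureHistoryAutonomyExistence
import Summits.QuantumFields.BalabanUV.Beta.EriceRemainderEnclosureHistoryAutonomyMonotoneGeneral

/-!
# EriceRemainderEnclosureHistoryAutonomyOrder — (E48a) ORDER COSTS NOTHING BEYOND UNIQUENESS: in EVERY uniqueness regime of the flow with memory
# `1∕h(m+1)² = 1∕h(m)² + B(h(m+1), h(m+2), …)` (zeroth moment `M` of ANY size, floor `b > 0` on ]0,γ]; at most one box solution from each pin —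
# e.g. (E38a)'s CLOSED threshold `M·γ ≤ 3√3·b`, or (E43b)'s ISOTONE memory of any size) the box solution is STRICTLY INCREASING IN THE PIN AT EVERY
# SCALE: pins `t < t′` ⟹ `h_j < h′_j` for all `j` — trajectories of one flow never meet and never cross.  Mechanism: the tail of a solution is the
# solution from its own value (autonomy + uniqueness), so the scale maps are the ITERATES `h_j = f^[j](g_IR)` of ONE one-step map `f : p ↦ (solution
# from p)₁`; `f` is INJECTIVE (the scale-0 equation `1∕f(p)² − B(solution from f(p)) = 1∕p²` recovers the pin from `f(p)`) and CONTINUOUS ((E40):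
# continuity at every point of uniqueness), hence strictly monotone on the interval ]0,γ], increasing since `f(p) < p`

Cell `pub-balaban`, β-function sub-cell, BINDER row D4 «RemainderConst leaves for Bałaban's split» (`HOME/BINDER-OWNERS.md`; owner lineage `b2b-balaban-beta-an4`;
this file by co-owner #2 lineage `b2b-balaban-beta-d4-p2`, generation 45), β-FLOW TEAM duty (1), FREEZE (0) honoured (def-free; node U2's `MemFlow` ∕ `SeqBox` ∕
`seqBox_shift`, (E37b)'s `le_upper_zm`, (E38a)'s `memFlow_unique_zs_closed`, (E39)'s `exists_memFlow_zm`, (E40)'s `tendsto_of_memFlow_unique`, (E43b)'s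
`memFlow_unique_of_monotone_zm` BY NAME, nothing restated; Mathlib's `ContinuousOn.strictMonoOn_of_injOn_Icc`).  Sequel of (E38a) `…HistoryAutonomyThreshold`,
(E39) `…HistoryAutonomyExistence`, (E40) `…HistoryAutonomyContinuity`, (E43b) `…HistoryAutonomyMonotoneGeneral`.  Companions: (E48b) `…HistoryAutonomyOrderMarkov`
(the flow with memory IS the Markov flow of the effective β-function `Φ_B = B ∘ S_B`), (E48c) `…HistoryAutonomyOrderScreening` (isotone memory screens, antitone
memory anti-screens the infrared difference), (E48d) `…HistoryAutonomyOrderWitness` (above the threshold order FAILS: node U2's bump, pins `9∕10 < 1`, `h_1 > h′_1`),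
(E48e) `…HistoryAutonomyOrderEnd` (ENDs: the continuum running coupling `gstar` is strictly increasing in `g_IR`; a Markov law for it under (E38d)'s binder list).

HONEST FRAMING (page 1, verbatim and binding).  *"Discharging BetaPertH makes Bałaban's UV stability UNCONDITIONAL — a real constructive-QFT result; it is
NOT the continuum limit and NOT the Clay problem."*  THIS FILE DISCHARGES NOTHING OF THE KIND.  Pure real analysis about an ABSTRACT functional `B : (ℕ → ℝ) → ℝ`
with displayed zeroth moment `M` and floor `b` on the box ]0,γ]^ℕ — hypotheses, not facts; which modulus Bałaban's limit functional has, and on which side of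
the threshold it sits, is NOT PRINTED ([I] p. 298: the dependence on the preceding couplings exists, qualitatively; GAPS G-t4-U2-1∕-2) and not asserted.
Row D4 class UNCHANGED (critical-path width 0; instance 0∕1; D4 DISCHARGE NO DATE).  HONEST DEPENDENCY: continuum YM on T⁴ ⇐ BetaPertH ∧ nine spine
estimates (0/9 proved); BetaPertH ⇐ (D1) ∧ (D4) ∧ CAP+tail; G-an2-4 gates asym, D1 and NE2/3/4.

THE POINT (census sense (α); the AUTONOMY row — the ORDER of its trajectories).  (E37b)–(E47) settled WHEN the pair (functional, pin) determines the
trajectory and HOW it depends on that pair (Lipschitz ∕ Hölder ∕ no rate).  The question here is the ORDER STRUCTURE of the solution family in the pin: is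
the continuum running coupling at every scale an increasing function of its infrared value — do two trajectories of one flow never cross?  For a MARKOV
functional this is one-step bookkeeping; with memory the unknown future enters every scale equation and no scale-by-scale induction is available (a
contraction argument bounds the wrong-order part of the discrepancy by `q` times the right-order part — no contradiction).  The answer is structural and
costs nothing beyond uniqueness (§§2–3): let `S p` be the box solution from the pin `p ∈ ]0,γ]` ((E39): it exists for every zeroth-moment functional with
floor).  AUTONOMY: the tail `(S p)(n + ·)` is a box solution from `S p n`, so by uniqueness `(S p)(n + ·) = S (S p n)` and `S p j = f^[j] p` with the ONE-STEP
MAP `f p = S p 1` (§2).  INJECTIVITY: `f p = f p′` forces `S p (1 + ·) = S p′ (1 + ·)`, equal memory terms at scale `0`, hence `1∕p² = 1∕f(p)² − B(S p (1+·)) = 1∕p′²`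
(§2 `injOn_oneStep`).  CONTINUITY: (E40)'s sequential continuity at every point of uniqueness, read through `Filter.tendsto_iff_seq_tendsto` (§2
`continuousOn_family`, agewise; `tendsto_family` also uniformly in the age).  A continuous injective function on an interval is strictly monotone, and
`f p < p` excludes decreasing (§3 `strictMonoOn_oneStep`); iterating, every scale map `p ↦ S p j` is strictly increasing (§3 `strictMonoOn_scale`).  Hence
(§4) **`lt_of_pin_lt`**: under uniqueness on ]0,γ], pins `t < t′` give `h_j < h′_j` at EVERY scale for ANY box solutions `h, h′`; instances **`lt_of_pin_lt_zs_closed`**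
(`M·γ ≤ 3√3·b`, (E38a)) and **`lt_of_pin_lt_of_monotone_zm`** (isotone memory of ANY size, (E43b)); corollaries: weak order, the recursion variables are ordered
(`1∕h′_j² < 1∕h_j²`), trajectories from distinct pins never MEET at any scale.  So in the census the AUTONOMY row's ORDER threshold is AT LEAST the uniqueness
threshold `3√3` (and for isotone memory there is none); (E48d) shows order fails where uniqueness fails (node U2's bump at ratio `10`): the two thresholds
COINCIDE on the witnesses known.  NOT claimed: order between solutions of two DIFFERENT functionals (false in general without a sign: (E48c) treats the signed
classes); anything about Bałaban's (1.22); whether its limit functional is below the threshold.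

WHAT IS PROVED ([folklore]; 0 `def`, 0 sorry).  §1 `memFlow_tail`, `lt_prev_of_memFlow`, `strictAnti_of_memFlow`, `le_pin_of_memFlow`.  §2 (a family `S` of box
solutions indexed by the pin + uniqueness on ]0,γ]) `family_tail_eq`, `family_succ_eq`, **`family_eq_iterate`**, **`injOn_oneStep`**, **`tendsto_family`** (agewise AND
uniformly in the age), **`continuousOn_family`**.  §3 `oneStep_lt`, **`strictMonoOn_oneStep`**, **`strictMonoOn_scale`**, `strictMonoOn_family` (order embedding).  §4 **`lt_of_pin_lt`**,
`le_of_pin_le`, `one_div_sq_lt_of_pin_lt`, `ne_of_pin_ne`, `succ_eq_oneStep_of_memFlow`, **`lt_of_pin_lt_zs_closed`**, **`lt_of_pin_lt_of_monotone_zm`**.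
-/

noncomputable section
open Filter Topology Finset Set

namespace Summit.QuantumFields.BalabanUV.Beta.EriceRemainderEnclosureHistoryAutonomyOrder

open Literature.MathematicalPhysics.QuantumFieldTheory.Balaban1983to89
open Literature.MathematicalPhysics.QuantumFieldTheory.Balaban1983to89.T4BetaStationary
open Literature.MathematicalPhysics.QuantumFieldTheory.Balaban1983to89.T4BetaFlowWellPosed
open Summit.QuantumFields.BalabanUV.Beta.EriceRemainderEnclosureHistoryAutonomyWellPosed (le_upper_zm)
open Summit.QuantumFields.BalabanUV.Beta.EriceRemainderEnclosureHistoryAutonomyThreshold (memFlow_unique_zs_closed)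
open Summit.QuantumFields.BalabanUV.Beta.EriceRemainderEnclosureHistoryAutonomyExistence (exists_memFlow_zm)
open Summit.QuantumFields.BalabanUV.Beta.EriceRemainderEnclosureHistoryAutonomyContinuity (tendsto_of_memFlow_unique)
open Summit.QuantumFields.BalabanUV.Beta.EriceRemainderEnclosureHistoryAutonomyMonotoneGeneral (memFlow_unique_of_monotone_zm)

variable {B : (ℕ → ℝ) → ℝ} {M γ b gIR : ℝ} {h h' : ℕ → ℝ} {S : ℝ → ℕ → ℝ}

/-! ## §1 Tails of solutions are solutions; solutions decrease strictly -/

/-- **AUTONOMY AT THE LEVEL OF SOLUTIONS**: the ultraviolet tail `(h n, h (n+1), …)` of a solution of the flow with memory from `gIR` is a solution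
of the SAME flow from the pin `h n` — the functional is scale-independent. [folklore] -/
theorem memFlow_tail (hf : MemFlow B gIR h) (n : ℕ) : MemFlow B (h n) (fun j => h (n + j)) := by
  refine ⟨by simp, fun m => ?_⟩
  have e : (fun j => h (n + (m + 1 + j))) = fun j => h (n + m + 1 + j) :=
    funext fun j => by rw [show n + (m + 1 + j) = n + m + 1 + j by omega]
  show 1 / h (n + (m + 1)) ^ 2 = 1 / h (n + m) ^ 2 + B (fun j => h (n + (m + 1 + j)))
  rw [e, show n + (m + 1) = n + m + 1 by omega]
  exact hf.2 (n + m)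

/-- A box solution of a flow with a positive floor DECREASES STRICTLY towards the ultraviolet: `h (m+1) < h m`. [folklore] -/
theorem lt_prev_of_memFlow (hb : 0 < b) (hlo : ∀ u, SeqBox γ u → b ≤ B u) (hh : SeqBox γ h) (hf : MemFlow B gIR h) (m : ℕ) :
    h (m + 1) < h m := by
  have h0 := (hh m).1
  have h1 := (hh (m + 1)).1
  have hfl : b ≤ B (fun j => h (m + 1 + j)) := hlo _ (seqBox_shift hh (m + 1))
  have hlt : 1 / h m ^ 2 < 1 / h (m + 1) ^ 2 := by rw [hf.2 m]; linarith
  have hsq : h (m + 1) ^ 2 < h m ^ 2 := (one_div_lt_one_div (by positivity) (by positivity)).1 hlt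
  exact lt_of_pow_lt_pow_left₀ 2 h0.le hsq

/-- Hence a box solution is strictly antitone in the scale. [folklore] -/
theorem strictAnti_of_memFlow (hb : 0 < b) (hlo : ∀ u, SeqBox γ u → b ≤ B u) (hh : SeqBox γ h) (hf : MemFlow B gIR h) :
    StrictAnti h :=
  strictAnti_nat_of_succ_lt fun m => lt_prev_of_memFlow hb hlo hh hf m

/-- … and stays below its pin: `h j ≤ gIR`. [folklore] -/
theorem le_pin_of_memFlow (hb : 0 < b) (hlo : ∀ u, SeqBox γ u → b ≤ B u) (hh : SeqBox γ h) (hf : MemFlow B gIR h) (j : ℕ) :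
    h j ≤ gIR := by
  rw [← hf.1]
  exact (strictAnti_of_memFlow hb hlo hh hf).antitone (Nat.zero_le j)

/-! ## §2 A family of box solutions indexed by the pin, under uniqueness: iterates of one injective continuous one-step map

Throughout: `hS : ∀ p, 0 < p → p ≤ γ → SeqBox γ (S p) ∧ MemFlow B p (S p)` (a box solution from every pin of ]0,γ] — (E39) supplies one for
every zeroth-moment functional with floor) and `huniq` (at most one box solution from every pin of ]0,γ]). -/

/-- The family starts at its pin. [folklore] -/
theorem family_zero (hS : ∀ p, 0 < p → p ≤ γ → SeqBox γ (S p) ∧ MemFlow B p (S p)) {p : ℝ} (hp0 : 0 < p) (hpγ : p ≤ γ) :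
    S p 0 = p :=
  (hS p hp0 hpγ).2.1

/-- The family is box-valued: `0 < S p j ≤ γ`. [folklore] -/
theorem family_mem (hS : ∀ p, 0 < p → p ≤ γ → SeqBox γ (S p) ∧ MemFlow B p (S p)) {p : ℝ} (hp0 : 0 < p) (hpγ : p ≤ γ)
    (j : ℕ) : S p j ∈ Ioc 0 γ :=
  ⟨((hS p hp0 hpγ).1 j).1, ((hS p hp0 hpγ).1 j).2⟩

/-- **AUTONOMY + UNIQUENESS**: the tail of the solution from `p` beyond scale `n` IS the solution from `S p n`. [folklore] -/
theorem family_tail_eq (hS : ∀ p, 0 < p → p ≤ γ → SeqBox γ (S p) ∧ MemFlow B p (S p))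
    (huniq : ∀ p, 0 < p → p ≤ γ → ∀ u u' : ℕ → ℝ, SeqBox γ u → SeqBox γ u' → MemFlow B p u → MemFlow B p u' → u = u')
    {p : ℝ} (hp0 : 0 < p) (hpγ : p ≤ γ) (n : ℕ) : (fun j => S p (n + j)) = S (S p n) := by
  have hq := family_mem hS hp0 hpγ n
  exact huniq (S p n) hq.1 hq.2 _ _ (seqBox_shift (hS p hp0 hpγ).1 n) (hS _ hq.1 hq.2).1
    (memFlow_tail (hS p hp0 hpγ).2 n) (hS _ hq.1 hq.2).2

/-- One more scale = one application of the ONE-STEP MAP `p ↦ S p 1`: `S p (n+1) = S (S p n) 1`. [folklore] -/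
theorem family_succ_eq (hS : ∀ p, 0 < p → p ≤ γ → SeqBox γ (S p) ∧ MemFlow B p (S p))
    (huniq : ∀ p, 0 < p → p ≤ γ → ∀ u u' : ℕ → ℝ, SeqBox γ u → SeqBox γ u' → MemFlow B p u → MemFlow B p u' → u = u')
    {p : ℝ} (hp0 : 0 < p) (hpγ : p ≤ γ) (n : ℕ) : S p (n + 1) = S (S p n) 1 := by
  have := congrFun (family_tail_eq hS huniq hp0 hpγ n) 1
  simpa using this

/-- **THE SCALE MAPS ARE ITERATES OF THE ONE-STEP MAP**: `S p j = (a ↦ S a 1)^[j] p` — below the threshold the flow with memory, read on its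
solutions, is a one-dimensional autonomous dynamics. [folklore] -/
theorem family_eq_iterate (hS : ∀ p, 0 < p → p ≤ γ → SeqBox γ (S p) ∧ MemFlow B p (S p))
    (huniq : ∀ p, 0 < p → p ≤ γ → ∀ u u' : ℕ → ℝ, SeqBox γ u → SeqBox γ u' → MemFlow B p u → MemFlow B p u' → u = u')
    {p : ℝ} (hp0 : 0 < p) (hpγ : p ≤ γ) : ∀ j : ℕ, S p j = (fun a => S a 1)^[j] p
  | 0 => by rw [Function.iterate_zero_apply, family_zero hS hp0 hpγ]
  | j + 1 => by rw [Function.iterate_succ_apply', ← family_eq_iterate hS huniq hp0 hpγ j, family_succ_eq hS huniq hp0 hpγ j]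

/-- **THE ONE-STEP MAP IS INJECTIVE on ]0,γ]**: `S p 1 = S p′ 1` makes the two tails beyond scale `1` the same solution, hence the two memory
terms at scale `0` equal, and the scale-0 equations `1∕(S p 1)² = 1∕p² + B(S p (1+·))` return `1∕p² = 1∕p′²`. [folklore] -/
theorem injOn_oneStep (hS : ∀ p, 0 < p → p ≤ γ → SeqBox γ (S p) ∧ MemFlow B p (S p))
    (huniq : ∀ p, 0 < p → p ≤ γ → ∀ u u' : ℕ → ℝ, SeqBox γ u → SeqBox γ u' → MemFlow B p u → MemFlow B p u' → u = u') :
    InjOn (fun p => S p 1) (Ioc 0 γ) := by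
  intro p hp p' hp' hpp'
  simp only at hpp'
  have e1 := family_tail_eq hS huniq hp.1 hp.2 1
  have e2 := family_tail_eq hS huniq hp'.1 hp'.2 1
  have heq : (fun j => S p (1 + j)) = fun j => S p' (1 + j) := by rw [e1, e2, hpp']
  have h0 := (hS p hp.1 hp.2).2.2 0
  have h0' := (hS p' hp'.1 hp'.2).2.2 0
  rw [family_zero hS hp.1 hp.2] at h0
  rw [family_zero hS hp'.1 hp'.2] at h0'
  simp only [zero_add] at h0 h0'
  rw [hpp', heq] at h0
  have hinv : 1 / p ^ 2 = 1 / p' ^ 2 := by linarith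
  have hsq : p ^ 2 = p' ^ 2 := by
    have := congrArg (fun x : ℝ => 1 / x) hinv
    simpa only [one_div_one_div] using this
  exact (sq_eq_sq₀ hp.1.le hp'.1.le).1 hsq

/-- The zeroth moment bounds the functional on the box: `B ≤ B(γ, γ, …) + M·γ` ((E37b) `le_upper_zm`). [folklore] -/
theorem le_upper_of_zm
    (hB : ∀ u u' : ℕ → ℝ, SeqBox γ u → SeqBox γ u' → ∀ D : ℝ, (∀ j, |u j - u' j| ≤ D) → |B u - B u'| ≤ M * D)
    (hγ : 0 < γ) : ∀ u, SeqBox γ u → B u ≤ B (fun _ => γ) + M * γ :=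
  fun _ hu => le_upper_zm hB hγ hu

/-- **CONTINUITY OF THE FAMILY IN THE PIN, agewise AND uniformly in the age** (sequential form): pins `g_n → p` inside `[p∕2, γ]` give
`S (g_n) j → S p j` for every `j` and `sup_j |S (g_n) j − S p j| → 0` — (E40)'s continuity at every point of uniqueness with the constant sequence of
functionals `B_n = B`. [folklore] -/
theorem tendsto_family (hb : 0 < b) (hγ : 0 < γ)
    (hB : ∀ u u' : ℕ → ℝ, SeqBox γ u → SeqBox γ u' → ∀ D : ℝ, (∀ j, |u j - u' j| ≤ D) → |B u - B u'| ≤ M * D)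
    (hM : 0 ≤ M) (hlo : ∀ u, SeqBox γ u → b ≤ B u)
    (hS : ∀ p, 0 < p → p ≤ γ → SeqBox γ (S p) ∧ MemFlow B p (S p))
    (huniq : ∀ p, 0 < p → p ≤ γ → ∀ u u' : ℕ → ℝ, SeqBox γ u → SeqBox γ u' → MemFlow B p u → MemFlow B p u' → u = u')
    {p : ℝ} (hp : p ∈ Ioc 0 γ) {g : ℕ → ℝ} (hg : ∀ n, p / 2 ≤ g n ∧ g n ≤ γ) (hgt : Tendsto g atTop (𝓝 p)) :
    (∀ j, Tendsto (fun n => S (g n) j) atTop (𝓝 (S p j))) ∧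
      ∀ ε : ℝ, 0 < ε → ∀ᶠ n in atTop, ∀ j, |S (g n) j - S p j| ≤ ε := by
  have hg0 : 0 < p / 2 := by linarith [hp.1]
  have hgn : ∀ n, 0 < g n ∧ g n ≤ γ := fun n => ⟨hg0.trans_le (hg n).1, (hg n).2⟩
  obtain ⟨k, hk, hfk, hpt, hunif⟩ := tendsto_of_memFlow_unique (Bn := fun _ => B) (η := fun _ => 0) (gn := g)
    (hn := fun n => S (g n)) hb hγ hB hM (fun _ => hlo) (fun _ => le_upper_of_zm hB hγ) (fun _ u _ => by simp)
    tendsto_const_nhds hg0 hg hgt hp.1 (fun n => (hS (g n) (hgn n).1 (hgn n).2).1)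
    (fun n => (hS (g n) (hgn n).1 (hgn n).2).2) (huniq p hp.1 hp.2)
  have hkS : k = S p := huniq p hp.1 hp.2 _ _ hk (hS p hp.1 hp.2).1 hfk (hS p hp.1 hp.2).2
  rw [hkS] at hpt hunif
  exact ⟨hpt, hunif⟩

/-- **THE SCALE MAPS ARE CONTINUOUS ON ]0,γ]**: `p ↦ S p j` is continuous on `Ioc 0 γ` for every `j` (sequences → filters by
`Filter.tendsto_iff_seq_tendsto`; a sequence tending to `p` within ]0,γ] is eventually in `[p∕2, γ]`). [folklore] -/
theorem continuousOn_family (hb : 0 < b) (hγ : 0 < γ)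
    (hB : ∀ u u' : ℕ → ℝ, SeqBox γ u → SeqBox γ u' → ∀ D : ℝ, (∀ j, |u j - u' j| ≤ D) → |B u - B u'| ≤ M * D)
    (hM : 0 ≤ M) (hlo : ∀ u, SeqBox γ u → b ≤ B u)
    (hS : ∀ p, 0 < p → p ≤ γ → SeqBox γ (S p) ∧ MemFlow B p (S p))
    (huniq : ∀ p, 0 < p → p ≤ γ → ∀ u u' : ℕ → ℝ, SeqBox γ u → SeqBox γ u' → MemFlow B p u → MemFlow B p u' → u = u')
    (j : ℕ) : ContinuousOn (fun p => S p j) (Ioc 0 γ) := by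
  intro p hp
  rw [ContinuousWithinAt, tendsto_iff_seq_tendsto]
  intro g hg
  rw [tendsto_nhdsWithin_iff] at hg
  set g' : ℕ → ℝ := fun n => if p / 2 ≤ g n ∧ g n ≤ γ then g n else p with hg'
  have hgb : ∀ n, p / 2 ≤ g' n ∧ g' n ≤ γ := by
    intro n
    by_cases hc : p / 2 ≤ g n ∧ g n ≤ γ
    · simp only [hg', hc, and_self, if_true]
    · simp only [hg', hc, if_false]; exact ⟨by linarith [hp.1], hp.2⟩
  have hev : ∀ᶠ n in atTop, g' n = g n := by
    have h1 : ∀ᶠ n in atTop, p / 2 < g n := (tendsto_order.1 hg.1).1 _ (by linarith [hp.1])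
    filter_upwards [h1, hg.2] with n hn1 hn2
    simp only [hg', hn1.le, hn2.2, and_self, if_true]
  have hg't : Tendsto g' atTop (𝓝 p) := hg.1.congr' (hev.mono fun n hn => hn.symm)
  have hlim := (tendsto_family hb hγ hB hM hlo hS huniq hp hgb hg't).1 j
  refine hlim.congr' ?_
  filter_upwards [hev] with n hn
  simp only [Function.comp, hn]

/-! ## §3 The one-step map is strictly increasing; so is every scale map -/

/-- One step loses coupling: `S p 1 < p`. [folklore] -/
theorem oneStep_lt (hb : 0 < b) (hlo : ∀ u, SeqBox γ u → b ≤ B u)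
    (hS : ∀ p, 0 < p → p ≤ γ → SeqBox γ (S p) ∧ MemFlow B p (S p)) {p : ℝ} (hp0 : 0 < p) (hpγ : p ≤ γ) : S p 1 < p := by
  have := lt_prev_of_memFlow hb hlo (hS p hp0 hpγ).1 (hS p hp0 hpγ).2 0
  rwa [zero_add, family_zero hS hp0 hpγ] at this

/-- **THE ONE-STEP MAP IS STRICTLY INCREASING ON ]0,γ]**: continuous and injective on every `[a, t′] ⊆ ]0,γ]` (§2), hence strictly monotone there
(`ContinuousOn.strictMonoOn_of_injOn_Icc`); with `a = min t (S t′ 1)` the endpoint values are ordered, `S a 1 < a ≤ S t′ 1`, so it is increasing. [folklore] -/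
theorem strictMonoOn_oneStep (hb : 0 < b) (hγ : 0 < γ)
    (hB : ∀ u u' : ℕ → ℝ, SeqBox γ u → SeqBox γ u' → ∀ D : ℝ, (∀ j, |u j - u' j| ≤ D) → |B u - B u'| ≤ M * D)
    (hM : 0 ≤ M) (hlo : ∀ u, SeqBox γ u → b ≤ B u)
    (hS : ∀ p, 0 < p → p ≤ γ → SeqBox γ (S p) ∧ MemFlow B p (S p))
    (huniq : ∀ p, 0 < p → p ≤ γ → ∀ u u' : ℕ → ℝ, SeqBox γ u → SeqBox γ u' → MemFlow B p u → MemFlow B p u' → u = u') :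
    StrictMonoOn (fun p => S p 1) (Ioc 0 γ) := by
  intro t ht t' ht' htt'
  set a : ℝ := min t (S t' 1) with ha
  have ha0 : 0 < a := lt_min ht.1 (family_mem hS ht'.1 ht'.2 1).1
  have hat : a ≤ t := min_le_left _ _
  have hat' : a ≤ t' := hat.trans htt'.le
  have haγ : a ≤ γ := hat.trans ht.2
  have hsub : Icc a t' ⊆ Ioc 0 γ := fun x hx => ⟨ha0.trans_le hx.1, hx.2.trans ht'.2⟩
  have hfa : S a 1 ≤ S t' 1 := ((oneStep_lt hb hlo hS ha0 haγ).trans_le (min_le_right _ _)).le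
  have hmono : StrictMonoOn (fun p => S p 1) (Icc a t') :=
    ContinuousOn.strictMonoOn_of_injOn_Icc (f := fun p => S p 1) hat' hfa
      ((continuousOn_family hb hγ hB hM hlo hS huniq 1).mono hsub) ((injOn_oneStep hS huniq).mono hsub)
  exact hmono ⟨hat, htt'.le⟩ ⟨hat', le_rfl⟩ htt'

/-- **EVERY SCALE MAP `p ↦ S p j` IS STRICTLY INCREASING ON ]0,γ]** — iterate the one-step map. [folklore] -/
theorem strictMonoOn_scale (hb : 0 < b) (hγ : 0 < γ)
    (hB : ∀ u u' : ℕ → ℝ, SeqBox γ u → SeqBox γ u' → ∀ D : ℝ, (∀ j, |u j - u' j| ≤ D) → |B u - B u'| ≤ M * D)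
    (hM : 0 ≤ M) (hlo : ∀ u, SeqBox γ u → b ≤ B u)
    (hS : ∀ p, 0 < p → p ≤ γ → SeqBox γ (S p) ∧ MemFlow B p (S p))
    (huniq : ∀ p, 0 < p → p ≤ γ → ∀ u u' : ℕ → ℝ, SeqBox γ u → SeqBox γ u' → MemFlow B p u → MemFlow B p u' → u = u') :
    ∀ j : ℕ, StrictMonoOn (fun p => S p j) (Ioc 0 γ)
  | 0 => fun t ht t' ht' htt' => by
      show S t 0 < S t' 0
      rw [family_zero hS ht.1 ht.2, family_zero hS ht'.1 ht'.2]; exact htt'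
  | j + 1 => fun t ht t' ht' htt' => by
      show S t (j + 1) < S t' (j + 1)
      rw [family_succ_eq hS huniq ht.1 ht.2 j, family_succ_eq hS huniq ht'.1 ht'.2 j]
      exact strictMonoOn_oneStep hb hγ hB hM hlo hS huniq (family_mem hS ht.1 ht.2 j) (family_mem hS ht'.1 ht'.2 j)
        (strictMonoOn_scale hb hγ hB hM hlo hS huniq j ht ht' htt')

/-- **THE SOLUTION FAMILY IS AN ORDER EMBEDDING OF ]0,γ] INTO THE BOX**: `p ↦ S p` is strictly increasing for the pointwise order on `ℕ → ℝ`. [folklore] -/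
theorem strictMonoOn_family (hb : 0 < b) (hγ : 0 < γ)
    (hB : ∀ u u' : ℕ → ℝ, SeqBox γ u → SeqBox γ u' → ∀ D : ℝ, (∀ j, |u j - u' j| ≤ D) → |B u - B u'| ≤ M * D)
    (hM : 0 ≤ M) (hlo : ∀ u, SeqBox γ u → b ≤ B u)
    (hS : ∀ p, 0 < p → p ≤ γ → SeqBox γ (S p) ∧ MemFlow B p (S p))
    (huniq : ∀ p, 0 < p → p ≤ γ → ∀ u u' : ℕ → ℝ, SeqBox γ u → SeqBox γ u' → MemFlow B p u → MemFlow B p u' → u = u') :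
    StrictMonoOn S (Ioc 0 γ) := fun _ ht _ ht' htt' =>
  Pi.lt_def.2 ⟨fun j => (strictMonoOn_scale hb hγ hB hM hlo hS huniq j ht ht' htt').le,
    ⟨0, strictMonoOn_scale hb hγ hB hM hlo hS huniq 0 ht ht' htt'⟩⟩

/-! ## §4 THE ORDER THEOREM: in every uniqueness regime the box solution is strictly increasing in the pin at every scale -/

/-- **ORDER COSTS NOTHING BEYOND UNIQUENESS.**  `B` with a zeroth moment `M ≥ 0` of ANY size and a floor `b > 0` on ]0,γ], and AT MOST ONE box solution of
its flow with memory from every pin of ]0,γ].  Then for pins `0 < t < t′ ≤ γ` and ANY box solutions `h` from `t`, `h′` from `t′`:  `h j < h′ j` at EVERY scale —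
two trajectories of one flow never meet and never cross. [folklore] -/
theorem lt_of_pin_lt (hb : 0 < b)
    (hB : ∀ u u' : ℕ → ℝ, SeqBox γ u → SeqBox γ u' → ∀ D : ℝ, (∀ j, |u j - u' j| ≤ D) → |B u - B u'| ≤ M * D)
    (hM : 0 ≤ M) (hlo : ∀ u, SeqBox γ u → b ≤ B u)
    (huniq : ∀ p, 0 < p → p ≤ γ → ∀ u u' : ℕ → ℝ, SeqBox γ u → SeqBox γ u' → MemFlow B p u → MemFlow B p u' → u = u')
    {t t' : ℝ} (ht : 0 < t) (htt' : t < t') (ht'γ : t' ≤ γ) (hh : SeqBox γ h) (hh' : SeqBox γ h') (hf : MemFlow B t h)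
    (hf' : MemFlow B t' h') (j : ℕ) : h j < h' j := by
  have hex : ∀ p : ℝ, 0 < p → p ≤ γ → ∃ k : ℕ → ℝ, SeqBox γ k ∧ MemFlow B p k :=
    fun p hp0 hpγ => exists_memFlow_zm hB hM hp0 hpγ hb hlo
  choose! S hSbox hSflow using hex
  have hS : ∀ p, 0 < p → p ≤ γ → SeqBox γ (S p) ∧ MemFlow B p (S p) := fun p hp0 hpγ => ⟨hSbox p hp0 hpγ, hSflow p hp0 hpγ⟩
  have ht' : 0 < t' := ht.trans htt'
  have htγ : t ≤ γ := htt'.le.trans ht'γ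
  have hγ : 0 < γ := ht'.trans_le ht'γ
  have e1 : h = S t := huniq t ht htγ _ _ hh (hS t ht htγ).1 hf (hS t ht htγ).2
  have e2 : h' = S t' := huniq t' ht' ht'γ _ _ hh' (hS t' ht' ht'γ).1 hf' (hS t' ht' ht'γ).2
  rw [e1, e2]
  exact strictMonoOn_scale hb hγ hB hM hlo hS huniq j ⟨ht, htγ⟩ ⟨ht', ht'γ⟩ htt'

/-- WEAK ORDER: pins `t ≤ t′` give `h j ≤ h′ j` (equality of pins: uniqueness). [folklore] -/
theorem le_of_pin_le (hb : 0 < b)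
    (hB : ∀ u u' : ℕ → ℝ, SeqBox γ u → SeqBox γ u' → ∀ D : ℝ, (∀ j, |u j - u' j| ≤ D) → |B u - B u'| ≤ M * D)
    (hM : 0 ≤ M) (hlo : ∀ u, SeqBox γ u → b ≤ B u)
    (huniq : ∀ p, 0 < p → p ≤ γ → ∀ u u' : ℕ → ℝ, SeqBox γ u → SeqBox γ u' → MemFlow B p u → MemFlow B p u' → u = u')
    {t t' : ℝ} (ht : 0 < t) (htt' : t ≤ t') (ht'γ : t' ≤ γ) (hh : SeqBox γ h) (hh' : SeqBox γ h') (hf : MemFlow B t h)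
    (hf' : MemFlow B t' h') (j : ℕ) : h j ≤ h' j := by
  rcases htt'.eq_or_lt with heq | hlt
  · subst heq
    rw [huniq t ht ht'γ _ _ hh hh' hf hf']
  · exact (lt_of_pin_lt hb hB hM hlo huniq ht hlt ht'γ hh hh' hf hf' j).le

/-- THE RECURSION VARIABLES ARE ORDERED: pins `t < t′` give `1∕h′_j² < 1∕h_j²` at every scale (the signed discrepancy stays positive). [folklore] -/
theorem one_div_sq_lt_of_pin_lt (hb : 0 < b)
    (hB : ∀ u u' : ℕ → ℝ, SeqBox γ u → SeqBox γ u' → ∀ D : ℝ, (∀ j, |u j - u' j| ≤ D) → |B u - B u'| ≤ M * D)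
    (hM : 0 ≤ M) (hlo : ∀ u, SeqBox γ u → b ≤ B u)
    (huniq : ∀ p, 0 < p → p ≤ γ → ∀ u u' : ℕ → ℝ, SeqBox γ u → SeqBox γ u' → MemFlow B p u → MemFlow B p u' → u = u')
    {t t' : ℝ} (ht : 0 < t) (htt' : t < t') (ht'γ : t' ≤ γ) (hh : SeqBox γ h) (hh' : SeqBox γ h') (hf : MemFlow B t h)
    (hf' : MemFlow B t' h') (j : ℕ) : 1 / h' j ^ 2 < 1 / h j ^ 2 :=
  one_div_lt_one_div_of_lt (pow_pos (hh j).1 2)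
    (pow_lt_pow_left₀ (lt_of_pin_lt hb hB hM hlo huniq ht htt' ht'γ hh hh' hf hf' j) (hh j).1.le two_ne_zero)

/-- NO MEETING: trajectories of one flow from DISTINCT pins differ at EVERY scale. [folklore] -/
theorem ne_of_pin_ne (hb : 0 < b)
    (hB : ∀ u u' : ℕ → ℝ, SeqBox γ u → SeqBox γ u' → ∀ D : ℝ, (∀ j, |u j - u' j| ≤ D) → |B u - B u'| ≤ M * D)
    (hM : 0 ≤ M) (hlo : ∀ u, SeqBox γ u → b ≤ B u)
    (huniq : ∀ p, 0 < p → p ≤ γ → ∀ u u' : ℕ → ℝ, SeqBox γ u → SeqBox γ u' → MemFlow B p u → MemFlow B p u' → u = u')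
    {t t' : ℝ} (ht : 0 < t) (htγ : t ≤ γ) (ht' : 0 < t') (ht'γ : t' ≤ γ) (htt' : t ≠ t') (hh : SeqBox γ h) (hh' : SeqBox γ h')
    (hf : MemFlow B t h) (hf' : MemFlow B t' h') (j : ℕ) : h j ≠ h' j := by
  rcases lt_or_gt_of_ne htt' with hlt | hlt
  · exact (lt_of_pin_lt hb hB hM hlo huniq ht hlt ht'γ hh hh' hf hf' j).ne
  · exact (lt_of_pin_lt hb hB hM hlo huniq ht' hlt htγ hh' hh hf' hf j).ne'

/-- EVERY BOX SOLUTION ADVANCES BY THE ONE-STEP MAP of any family of box solutions: `h (j+1) = S (h j) 1` — the flow with memory, read on its solutions,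
is the autonomous one-dimensional recursion `h_{j+1} = f(h_j)`. [folklore] -/
theorem succ_eq_oneStep_of_memFlow
    (hS : ∀ p, 0 < p → p ≤ γ → SeqBox γ (S p) ∧ MemFlow B p (S p))
    (huniq : ∀ p, 0 < p → p ≤ γ → ∀ u u' : ℕ → ℝ, SeqBox γ u → SeqBox γ u' → MemFlow B p u → MemFlow B p u' → u = u')
    {t : ℝ} (ht : 0 < t) (htγ : t ≤ γ) (hh : SeqBox γ h) (hf : MemFlow B t h) (j : ℕ) : h (j + 1) = S (h j) 1 := by
  have e : h = S t := huniq t ht htγ _ _ hh (hS t ht htγ).1 hf (hS t ht htγ).2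
  rw [e]
  exact family_succ_eq hS huniq ht htγ j

/-- **ORDER ON THE CLOSED THRESHOLD**: zeroth moment `M`, floor `b > 0` on ]0,γ], `M·γ ≤ 3√3·b` ((E38a)'s uniqueness): pins `t < t′` in ]0,γ] give
`h j < h′ j` at every scale for the box solutions. [folklore] -/
theorem lt_of_pin_lt_zs_closed (hb : 0 < b)
    (hB : ∀ u u' : ℕ → ℝ, SeqBox γ u → SeqBox γ u' → ∀ D : ℝ, (∀ j, |u j - u' j| ≤ D) → |B u - B u'| ≤ M * D)
    (hM : 0 ≤ M) (hlo : ∀ u, SeqBox γ u → b ≤ B u) (hsmall : M * γ ≤ 3 * Real.sqrt 3 * b)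
    {t t' : ℝ} (ht : 0 < t) (htt' : t < t') (ht'γ : t' ≤ γ) (hh : SeqBox γ h) (hh' : SeqBox γ h') (hf : MemFlow B t h)
    (hf' : MemFlow B t' h') (j : ℕ) : h j < h' j :=
  lt_of_pin_lt hb hB hM hlo
    (fun _ hp0 hpγ _ _ hu hu' hfu hfu' => memFlow_unique_zs_closed hB hM hp0 hpγ hb hlo hsmall hu hu' hfu hfu')
    ht htt' ht'γ hh hh' hf hf' j

/-- **ORDER FOR ISOTONE MEMORY OF ANY SIZE**: `B` NON-DECREASING in the history (pointwise order on the box), zeroth moment `M` of ANY size, floor `b > 0`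
((E43b)'s uniqueness): pins `t < t′` in ]0,γ] give `h j < h′ j` at every scale — no smallness, no threshold. [folklore] -/
theorem lt_of_pin_lt_of_monotone_zm (hb : 0 < b)
    (hmono : ∀ u v : ℕ → ℝ, SeqBox γ u → SeqBox γ v → (∀ j, u j ≤ v j) → B u ≤ B v)
    (hB : ∀ u u' : ℕ → ℝ, SeqBox γ u → SeqBox γ u' → ∀ D : ℝ, (∀ j, |u j - u' j| ≤ D) → |B u - B u'| ≤ M * D)
    (hM : 0 ≤ M) (hlo : ∀ u, SeqBox γ u → b ≤ B u)
    {t t' : ℝ} (ht : 0 < t) (htt' : t < t') (ht'γ : t' ≤ γ) (hh : SeqBox γ h) (hh' : SeqBox γ h') (hf : MemFlow B t h)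
    (hf' : MemFlow B t' h') (j : ℕ) : h j < h' j :=
  lt_of_pin_lt hb hB hM hlo
    (fun _ hp0 _ _ _ hu hu' hfu hfu' => memFlow_unique_of_monotone_zm hmono hB hM hp0 hb hlo hu hu' hfu hfu')
    ht htt' ht'γ hh hh' hf hf' j

end Summit.QuantumFields.BalabanUV.Beta.EriceRemainderEnclosureHistoryAutonomyOrder

end
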